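import Summits.AtomisticToContinuum.Crystallization.Theorems.SquareWellLayerCakeGapTwelveToBarlowFiveFoldRing1


/-!
# Five-fold bonds are CLOSED rings of five tetrahedra — part 2/3: transversal frame and ring lemmas

Crux `SquareWellLayerCake.GapTwelveToBarlow` (stmt-AtomisticToContinuum-15807), line `Sketch`,
structural lemma S2α behind `stub_fiveFoldSubcubic`.  Around the bond axis `u = (x_k - x_j)/d`
write `x_l - x_j = P_l + s_l u`; for common neighbours `s_l ∈ [2/5, 3/5]`,
`(s_l - s_m)² ≤ 3/500`, `0.8243 ≤ |P_l| ≤ 0.876` (part 1), so the unit transversal directions in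
`u^⊥ ≃ ℂ` (`transversal_frame`) have pairwise `Re ≤ 2/5`, `≤ -1/9` for pairs `≥ 131/100` apart
and `> 0` for bonded pairs; with `cos 66° > 2/5`, `cos 96° > -1/9` and `4·66 + 96 = 360`:
* `card_bondedCommon_le_two` — a common neighbour of a bond is bonded to at most two others
  (separation only);
* `two_le_card_bondedCommon` — under the local extended gap and `card = 5`, to at least two;
* `fiveFold_ring_closed`, `fiveFold_ring_closed_of_deep` (verbatim vocabulary of the stub) — the
  bond graph on the five common neighbours is `2`-regular: the ring is closed;
* `stub_fiveFoldRingClosed` — the registered closed form.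
Mathlib + part 1 + the landed sign-lemma file only; no named fact is used.
-/

noncomputable section

namespace Summit.AtomisticToContinuum.Crystallization.Theorems.SquareWellLayerCakeGapTwelveToBarlow

open scoped InnerProductSpace ComplexConjugate Real

/-! ## The transversal frame of a bond -/

/-- **Transversal frame.**  For a bond `(j,k)` (`55/57 ≤ |x_j - x_k| ≤ 1`) and a set `S` of
common neighbours (each at distance `∈ [55/57, 1]` from both ends, pairwise `≥ 55/57` apart)
there are unit complex numbers `z l` (the transversal directions read in the plane
orthogonal to the bond, `≃ ℂ`) with: `Re (z l conj (z l')) ≤ 2/5` for `l ≠ l'`,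
`≤ -1/9` if `|x_l - x_l'| ≥ 131/100`, and `> 0` if `|x_l - x_l'| ≤ 1`. [folklore] -/
theorem transversal_frame {N : ℕ} (x : Fin N → EuclideanSpace ℝ (Fin 3)) (j k : Fin N)
    (hδd : (55 : ℝ) / 57 ≤ dist (x j) (x k)) (hdij : dist (x j) (x k) ≤ 1)
    (S : Finset (Fin N))
    (hS : ∀ l ∈ S, (55 : ℝ) / 57 ≤ dist (x j) (x l) ∧ dist (x j) (x l) ≤ 1 ∧
      (55 : ℝ) / 57 ≤ dist (x k) (x l) ∧ dist (x k) (x l) ≤ 1)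
    (hSS : ∀ l ∈ S, ∀ l' ∈ S, l ≠ l' → (55 : ℝ) / 57 ≤ dist (x l) (x l')) :
    ∃ z : Fin N → ℂ, (∀ l ∈ S, ‖z l‖ = 1) ∧
      (∀ l ∈ S, ∀ l' ∈ S, l ≠ l' → (z l * conj (z l')).re ≤ 2 / 5) ∧
      (∀ l ∈ S, ∀ l' ∈ S, (131 : ℝ) / 100 ≤ dist (x l) (x l') →
        (z l * conj (z l')).re ≤ -1 / 9) ∧
      (∀ l ∈ S, ∀ l' ∈ S, dist (x l) (x l') ≤ 1 → 0 < (z l * conj (z l')).re) := by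
  -- the bond length `d` and the unit axis `u`
  obtain ⟨d, hd⟩ : ∃ d : ℝ, d = dist (x j) (x k) := ⟨_, rfl⟩
  rw [← hd] at hδd hdij
  have hdpos : 0 < d := lt_of_lt_of_le (by norm_num) hδd
  have hnorm_kj : ‖x k - x j‖ = d := by rw [hd, dist_eq_norm, norm_sub_rev]
  obtain ⟨u, hu⟩ : ∃ u : EuclideanSpace ℝ (Fin 3), u = d⁻¹ • (x k - x j) := ⟨_, rfl⟩
  have hu1 : ‖u‖ = 1 := by
    rw [hu, norm_smul, norm_inv, Real.norm_eq_abs, abs_of_pos hdpos, hnorm_kj,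
      inv_mul_cancel₀ hdpos.ne']
  have huu : ⟪u, u⟫_ℝ = 1 := by rw [real_inner_self_eq_norm_sq, hu1, one_pow]
  have hxkj : x k - x j = d • u := by rw [hu, smul_smul, mul_inv_cancel₀ hdpos.ne', one_smul]
  -- axial coordinates `s` and transversal parts `P`
  obtain ⟨s, hs⟩ : ∃ s : Fin N → ℝ, ∀ l, s l = ⟪x l - x j, u⟫_ℝ := ⟨_, fun _ => rfl⟩
  obtain ⟨P, hP⟩ : ∃ P : Fin N → EuclideanSpace ℝ (Fin 3), ∀ l, P l = x l - x j - s l • u :=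
    ⟨_, fun _ => rfl⟩
  have hPu : ∀ l, ⟪P l, u⟫_ℝ = 0 := by
    intro l
    rw [hP, inner_sub_left, real_inner_smul_left, huu, ← hs l]
    ring
  have hli : ∀ l, x l - x j = P l + s l • u := by
    intro l
    rw [hP, sub_add_cancel]
  have hlk : ∀ l, x l - x k = P l + (s l - d) • u := by
    intro l
    rw [hP, sub_smul, ← hxkj]
    abel
  have hll : ∀ l l', x l - x l' = (P l - P l') + (s l - s l') • u := by
    intro l l'
    rw [hP, hP, sub_smul]
    abel
  have hA : ∀ l, ‖x l - x j‖ ^ 2 = ‖P l‖ ^ 2 + s l ^ 2 := by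
    intro l
    rw [hli]
    exact norm_add_smul_sq_of_inner_eq_zero hu1 (hPu l) _
  have hB : ∀ l, ‖x l - x k‖ ^ 2 = ‖P l‖ ^ 2 + (s l - d) ^ 2 := by
    intro l
    rw [hlk]
    exact norm_add_smul_sq_of_inner_eq_zero hu1 (hPu l) _
  have hD : ∀ l l', ‖x l - x l'‖ ^ 2 = ‖P l - P l'‖ ^ 2 + (s l - s l') ^ 2 := by
    intro l l'
    rw [hll]
    exact norm_add_smul_sq_of_inner_eq_zero hu1 (by rw [inner_sub_left, hPu, hPu, sub_zero]) _
  -- windows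
  have hsq : ∀ r : ℝ, 55 / 57 ≤ r → r ≤ 1 → (55 / 57 : ℝ) ^ 2 ≤ r ^ 2 ∧ r ^ 2 ≤ 1 :=
    fun r h1 h2 => ⟨pow_le_pow_left₀ (by norm_num) h1 2, pow_le_one₀ (by linarith) h2⟩
  have hAw : ∀ l ∈ S, (55 / 57 : ℝ) ^ 2 ≤ ‖x l - x j‖ ^ 2 ∧ ‖x l - x j‖ ^ 2 ≤ 1 := by
    intro l hl
    obtain ⟨h1, h2, -, -⟩ := hS l hl
    rw [← dist_eq_norm, dist_comm]
    exact hsq _ h1 h2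
  have hBw : ∀ l ∈ S, (55 / 57 : ℝ) ^ 2 ≤ ‖x l - x k‖ ^ 2 ∧ ‖x l - x k‖ ^ 2 ≤ 1 := by
    intro l hl
    obtain ⟨-, -, h1, h2⟩ := hS l hl
    rw [← dist_eq_norm, dist_comm]
    exact hsq _ h1 h2
  have hPle : ∀ l ∈ S, ‖P l‖ ^ 2 ≤ 9971 / 12996 := fun l hl =>
    transversal_sq_le hδd (hAw l hl).2 (hBw l hl).2 (hA l) (hB l)
  have hPge : ∀ l ∈ S, (6796 : ℝ) / 10000 ≤ ‖P l‖ ^ 2 := fun l hl =>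
    transversal_sq_ge hδd hdij (hAw l hl).1 (hAw l hl).2 (hBw l hl).1 (hBw l hl).2 (hA l) (hB l)
  have hPhi : ∀ l ∈ S, ‖P l‖ ≤ 0.876 := by
    intro l hl
    by_contra! h
    have := pow_lt_pow_left₀ h (by norm_num) two_ne_zero
    linarith [hPle l hl]
  have hPlo : ∀ l ∈ S, 0.8243 ≤ ‖P l‖ := by
    intro l hl
    by_contra! h
    have := pow_lt_pow_left₀ h (norm_nonneg _) two_ne_zero
    linarith [hPge l hl]
  have hP0 : ∀ l ∈ S, P l ≠ 0 := by
    intro l hl h0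
    have := hPlo l hl
    rw [h0, norm_zero] at this
    linarith
  have hPpos : ∀ l ∈ S, 0 < ‖P l‖ := fun l hl => norm_pos_iff.mpr (hP0 l hl)
  -- the three inner-product bounds
  have hΔ : ∀ l ∈ S, ∀ l' ∈ S, (s l - s l') ^ 2 ≤ 3 / 500 := fun l hl l' hl' =>
    axial_diff_sq_le hδd (hAw l hl).1 (hAw l hl).2 (hBw l hl).1 (hBw l hl).2
      (hAw l' hl').1 (hAw l' hl').2 (hBw l' hl').1 (hBw l' hl').2 (hA l) (hB l) (hA l') (hB l')
  have hall : ∀ l ∈ S, ∀ l' ∈ S, l ≠ l' → ⟪P l, P l'⟫_ℝ ≤ 2 / 5 * (‖P l‖ * ‖P l'‖) := by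
    intro l hl l' hl' hne
    have hDll : (55 / 57 : ℝ) ^ 2 ≤ ‖x l - x l'‖ ^ 2 :=
      pow_le_pow_left₀ (by norm_num) (by rw [← dist_eq_norm]; exact hSS l hl l' hl' hne) 2
    exact inner_le_two_fifths_mul (hPlo l hl) (hPhi l hl) (hPlo l' hl') (hPhi l' hl') (hPle l hl)
      (hPle l' hl') (norm_sub_sq_real (P l) (P l')) (by linarith [hD l l', hΔ l hl l' hl'])
  have hfar : ∀ l ∈ S, ∀ l' ∈ S, (131 : ℝ) / 100 ≤ dist (x l) (x l') →
      ⟪P l, P l'⟫_ℝ ≤ -(1 / 9) * (‖P l‖ * ‖P l'‖) := by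
    intro l hl l' hl' hfar'
    have hDll : (131 / 100 : ℝ) ^ 2 ≤ ‖x l - x l'‖ ^ 2 :=
      pow_le_pow_left₀ (by norm_num) (by rwa [← dist_eq_norm]) 2
    exact inner_le_neg_ninth_mul (hPle l hl) (hPle l' hl') (norm_sub_sq_real (P l) (P l'))
      (by linarith [hD l l', hΔ l hl l' hl'])
  have hbond : ∀ l ∈ S, ∀ l' ∈ S, dist (x l) (x l') ≤ 1 → 0 < ⟪P l, P l'⟫_ℝ := by
    intro l hl l' hl' hb
    have hDll : ‖x l - x l'‖ ^ 2 ≤ 1 := by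
      rw [← dist_eq_norm]
      exact pow_le_one₀ dist_nonneg hb
    exact inner_pos_of_bonded (hPge l hl) (hPge l' hl') (norm_sub_sq_real (P l) (P l'))
      (by nlinarith [hD l l', sq_nonneg (s l - s l')])
  -- the plane `u^⊥` is isometric to `ℂ`
  have hu0 : u ≠ 0 := fun h => by
    rw [h, norm_zero] at hu1
    exact zero_ne_one hu1
  haveI : Fact (Module.finrank ℝ (EuclideanSpace ℝ (Fin 3)) = 2 + 1) :=
    ⟨by rw [finrank_euclideanSpace_fin]⟩
  let Φ : (ℝ ∙ u)ᗮ ≃ₗᵢ[ℝ] ℂ :=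
    (Complex.isometryOfOrthonormal (OrthonormalBasis.fromOrthogonalSpanSingleton 2 hu0)).symm
  have hmemK : ∀ l, ‖P l‖⁻¹ • P l ∈ (ℝ ∙ u)ᗮ := fun l =>
    Submodule.mem_orthogonal_singleton_iff_inner_left.mpr
      (by rw [real_inner_smul_left, hPu l, mul_zero])
  obtain ⟨z, hz⟩ : ∃ z : Fin N → ℂ, ∀ l, z l = Φ ⟨‖P l‖⁻¹ • P l, hmemK l⟩ := ⟨_, fun _ => rfl⟩
  have hzre : ∀ l l', (z l * conj (z l')).re = (‖P l‖⁻¹ * ‖P l'‖⁻¹) * ⟪P l, P l'⟫_ℝ := by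
    intro l l'
    rw [← Complex.inner, hz, hz, LinearIsometryEquiv.inner_map_map, Submodule.coe_inner,
      Submodule.coe_mk, Submodule.coe_mk, real_inner_smul_left, real_inner_smul_right,
      real_inner_comm (P l) (P l')]
    ring
  refine ⟨z, ?_, ?_, ?_, ?_⟩
  · intro l hl
    rw [hz, LinearIsometryEquiv.norm_map, Submodule.coe_norm, Submodule.coe_mk]
    exact norm_smul_inv_norm (hP0 l hl)
  · intro l hl l' hl' hne
    have hkl : 0 < ‖P l‖ * ‖P l'‖ := mul_pos (hPpos l hl) (hPpos l' hl')
    rw [hzre, ← mul_inv, inv_mul_le_iff₀ hkl]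
    linarith [hall l hl l' hl' hne]
  · intro l hl l' hl' hfar'
    have hkl : 0 < ‖P l‖ * ‖P l'‖ := mul_pos (hPpos l hl) (hPpos l' hl')
    rw [hzre, ← mul_inv, inv_mul_le_iff₀ hkl]
    linarith [hfar l hl l' hl' hfar']
  · intro l hl l' hl' hb
    rw [hzre]
    exact mul_pos (mul_pos (inv_pos.mpr (hPpos l hl)) (inv_pos.mpr (hPpos l' hl')))
      (hbond l hl l' hl' hb)

/-! ## The ring lemmas -/

/-- Rotating by `conj (z l)`: real parts of relative positions are unchanged. [folklore] -/
theorem re_rot_mul_conj_rot {a b c : ℂ} (hc : c * conj c = 1) :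
    (a * conj c * conj (b * conj c)).re = (a * conj b).re := by
  rw [map_mul, Complex.conj_conj]
  have : a * conj c * (conj b * c) = a * conj b * (c * conj c) := by ring
  rw [this, hc, mul_one]

/-- **At most two bonded partners in the ring.**  In a configuration whose sites near `x j`
are `55/57`-separated from everything, every common neighbour `l` of a bond `(j,k)` is
bonded (distance `≤ 1`) to at most two other common neighbours of `(j,k)`. [folklore] -/
theorem card_bondedCommon_le_two {N : ℕ} (x : Fin N → EuclideanSpace ℝ (Fin 3)) (j k : Fin N)
    (hjk : j ≠ k) (hdjk : dist (x j) (x k) ≤ 1)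
    (hsep : ∀ j' : Fin N, dist (x j) (x j') ≤ 11 / 10 → ∀ k' : Fin N, k' ≠ j' →
      (55 : ℝ) / 57 ≤ dist (x j') (x k')) :
    ∀ l ∈ (Finset.univ.filter fun l : Fin N =>
        l ≠ j ∧ l ≠ k ∧ dist (x j) (x l) ≤ 1 ∧ dist (x k) (x l) ≤ 1),
      ((Finset.univ.filter fun l' : Fin N =>
          l' ≠ j ∧ l' ≠ k ∧ dist (x j) (x l') ≤ 1 ∧ dist (x k) (x l') ≤ 1).filter
        fun l' => l' ≠ l ∧ dist (x l) (x l') ≤ 1).card ≤ 2 := by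
  classical
  set S := Finset.univ.filter fun l : Fin N =>
    l ≠ j ∧ l ≠ k ∧ dist (x j) (x l) ≤ 1 ∧ dist (x k) (x l) ≤ 1 with hSdef
  intro l hl
  have hmem : ∀ l ∈ S, l ≠ j ∧ l ≠ k ∧ dist (x j) (x l) ≤ 1 ∧ dist (x k) (x l) ≤ 1 :=
    fun l hl => (Finset.mem_filter.mp hl).2
  have hsepj : ∀ k' : Fin N, k' ≠ j → (55 : ℝ) / 57 ≤ dist (x j) (x k') :=
    hsep j (by rw [dist_self]; norm_num)
  have hδd : (55 : ℝ) / 57 ≤ dist (x j) (x k) := hsepj k hjk.symm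
  have hS : ∀ l ∈ S, (55 : ℝ) / 57 ≤ dist (x j) (x l) ∧ dist (x j) (x l) ≤ 1 ∧
      (55 : ℝ) / 57 ≤ dist (x k) (x l) ∧ dist (x k) (x l) ≤ 1 := by
    intro l hl
    obtain ⟨hlj, hlk, hjl, hkl⟩ := hmem l hl
    exact ⟨hsepj l hlj, hjl, hsep k (by linarith) l hlk, hkl⟩
  have hSS : ∀ l ∈ S, ∀ l' ∈ S, l ≠ l' → (55 : ℝ) / 57 ≤ dist (x l) (x l') :=
    fun l hl l' _ hne => hsep l (by linarith [(hmem l hl).2.2.1]) l' hne.symm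
  obtain ⟨z, hz1, hzall, -, hzbond⟩ := transversal_frame x j k hδd hdjk S hS hSS
  set T := S.filter fun l' => l' ≠ l ∧ dist (x l) (x l') ≤ 1 with hTdef
  have hTmem : ∀ n ∈ T, n ∈ S ∧ n ≠ l ∧ dist (x l) (x n) ≤ 1 := fun n hn => by
    have h := Finset.mem_filter.mp hn
    exact ⟨h.1, h.2.1, h.2.2⟩
  have hzl : z l * conj (z l) = 1 := by
    rw [Complex.mul_conj, Complex.normSq_eq_norm_sq, hz1 l hl]
    norm_num
  refine card_le_two_of_re_nonneg T (fun n => z n * conj (z l)) ?_ ?_ ?_ ?_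
  · intro n hn
    rw [norm_mul, Complex.norm_conj, hz1 n (hTmem n hn).1, hz1 l hl, one_mul]
  · intro n hn
    obtain ⟨hnS, -, hd⟩ := hTmem n hn
    exact (hzbond n hnS l hl (by rwa [dist_comm])).le
  · intro n hn
    obtain ⟨hnS, hnl, -⟩ := hTmem n hn
    exact hzall n hnS l hl hnl
  · intro n hn n' hn' hne
    show (z n * conj (z l) * conj (z n' * conj (z l))).re ≤ 2 / 5
    rw [re_rot_mul_conj_rot hzl]
    exact hzall n (hTmem n hn).1 n' (hTmem n' hn').1 hne

/-- **At least two bonded partners in a five-ring under the gap.**  If moreover no two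
neighbours of `j` are at distance in `(1, 131/100)` and the bond `(j,k)` has exactly five
common neighbours, every common neighbour is bonded to at least two of the others.
[folklore] -/
theorem two_le_card_bondedCommon {N : ℕ} (x : Fin N → EuclideanSpace ℝ (Fin 3)) (j k : Fin N)
    (hjk : j ≠ k) (hdjk : dist (x j) (x k) ≤ 1)
    (hsep : ∀ j' : Fin N, dist (x j) (x j') ≤ 11 / 10 → ∀ k' : Fin N, k' ≠ j' →
      (55 : ℝ) / 57 ≤ dist (x j') (x k'))
    (hgap : ∀ l l' : Fin N, dist (x j) (x l) ≤ 1 → dist (x j) (x l') ≤ 1 →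
      1 < dist (x l) (x l') → (131 : ℝ) / 100 ≤ dist (x l) (x l'))
    (h5 : (Finset.univ.filter fun l : Fin N =>
        l ≠ j ∧ l ≠ k ∧ dist (x j) (x l) ≤ 1 ∧ dist (x k) (x l) ≤ 1).card = 5) :
    ∀ l ∈ (Finset.univ.filter fun l : Fin N =>
        l ≠ j ∧ l ≠ k ∧ dist (x j) (x l) ≤ 1 ∧ dist (x k) (x l) ≤ 1),
      2 ≤ ((Finset.univ.filter fun l' : Fin N =>
          l' ≠ j ∧ l' ≠ k ∧ dist (x j) (x l') ≤ 1 ∧ dist (x k) (x l') ≤ 1).filter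
        fun l' => l' ≠ l ∧ dist (x l) (x l') ≤ 1).card := by
  classical
  set S := Finset.univ.filter fun l : Fin N =>
    l ≠ j ∧ l ≠ k ∧ dist (x j) (x l) ≤ 1 ∧ dist (x k) (x l) ≤ 1 with hSdef
  intro l hl
  have hmem : ∀ l ∈ S, l ≠ j ∧ l ≠ k ∧ dist (x j) (x l) ≤ 1 ∧ dist (x k) (x l) ≤ 1 :=
    fun l hl => (Finset.mem_filter.mp hl).2
  have hsepj : ∀ k' : Fin N, k' ≠ j → (55 : ℝ) / 57 ≤ dist (x j) (x k') :=
    hsep j (by rw [dist_self]; norm_num)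
  have hδd : (55 : ℝ) / 57 ≤ dist (x j) (x k) := hsepj k hjk.symm
  have hS : ∀ l ∈ S, (55 : ℝ) / 57 ≤ dist (x j) (x l) ∧ dist (x j) (x l) ≤ 1 ∧
      (55 : ℝ) / 57 ≤ dist (x k) (x l) ∧ dist (x k) (x l) ≤ 1 := by
    intro l hl
    obtain ⟨hlj, hlk, hjl, hkl⟩ := hmem l hl
    exact ⟨hsepj l hlj, hjl, hsep k (by linarith) l hlk, hkl⟩
  have hSS : ∀ l ∈ S, ∀ l' ∈ S, l ≠ l' → (55 : ℝ) / 57 ≤ dist (x l) (x l') :=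
    fun l hl l' _ hne => hsep l (by linarith [(hmem l hl).2.2.1]) l' hne.symm
  obtain ⟨z, hz1, hzall, hzfar, -⟩ := transversal_frame x j k hδd hdjk S hS hSS
  set T := S.filter fun l' => l' ≠ l ∧ dist (x l) (x l') ≤ 1 with hTdef
  have hS5 : 4 < S.card := by
    rw [h5]
    norm_num
  have hzl : z l * conj (z l) = 1 := by
    rw [Complex.mul_conj, Complex.normSq_eq_norm_sq, hz1 l hl]
    norm_num
  have hw1 : ∀ n ∈ S, ‖z n * conj (z l)‖ = 1 := fun n hn => by
    rw [norm_mul, Complex.norm_conj, hz1 n hn, hz1 l hl, one_mul]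
  have hwsep : ∀ n ∈ S, ∀ n' ∈ S, n ≠ n' →
      (z n * conj (z l) * conj (z n' * conj (z l))).re ≤ 2 / 5 := fun n hn n' hn' hne => by
    rw [re_rot_mul_conj_rot hzl]
    exact hzall n hn n' hn' hne
  obtain ⟨m₁, hm₁S, hm₁l, him₁, hre₁⟩ :=
    exists_partner_of_five S (fun n => z n * conj (z l)) l hl hS5 hw1 hzl hwsep
  obtain ⟨m₂, hm₂S, hm₂l, him₂, hre₂⟩ :=
    exists_partner_of_five' S (fun n => z n * conj (z l)) l hl hS5 hw1 hzl hwsep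
  have hne : m₁ ≠ m₂ := by
    rintro rfl
    exact lt_asymm him₁ him₂
  have hbd : ∀ m ∈ S, -1 / 9 < (z m * conj (z l)).re → dist (x l) (x m) ≤ 1 := by
    intro m hmS hre
    by_contra! hgt
    have hfar' := hgap l m (hmem l hl).2.2.1 (hmem m hmS).2.2.1 hgt
    have := hzfar m hmS l hl (by rwa [dist_comm])
    linarith
  have hsub : ({m₁, m₂} : Finset (Fin N)) ⊆ T := by
    intro m hm
    rw [Finset.mem_insert, Finset.mem_singleton] at hm
    rw [hTdef, Finset.mem_filter]
    rcases hm with rfl | rfl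
    · exact ⟨hm₁S, hm₁l, hbd _ hm₁S hre₁⟩
    · exact ⟨hm₂S, hm₂l, hbd _ hm₂S hre₂⟩
  calc 2 = ({m₁, m₂} : Finset (Fin N)).card := (Finset.card_pair hne).symm
    _ ≤ T.card := Finset.card_le_card hsub

/-- **Closed ring (five-fold bonds are rings of five tetrahedra).**  In a configuration whose
sites near `x j` are `55/57`-separated from everything and in which no two neighbours of `j`
are at distance in `(1, 131/100)`, if the bond `(j,k)` has exactly five common neighbours then
each of them is bonded to exactly two of the others: the bond graph on the five common
neighbours is a `5`-cycle. [folklore] -/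
theorem fiveFold_ring_closed {N : ℕ} (x : Fin N → EuclideanSpace ℝ (Fin 3)) (j k : Fin N)
    (hjk : j ≠ k) (hdjk : dist (x j) (x k) ≤ 1)
    (hsep : ∀ j' : Fin N, dist (x j) (x j') ≤ 11 / 10 → ∀ k' : Fin N, k' ≠ j' →
      (55 : ℝ) / 57 ≤ dist (x j') (x k'))
    (hgap : ∀ l l' : Fin N, dist (x j) (x l) ≤ 1 → dist (x j) (x l') ≤ 1 →
      1 < dist (x l) (x l') → (131 : ℝ) / 100 ≤ dist (x l) (x l'))
    (h5 : (Finset.univ.filter fun l : Fin N =>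
        l ≠ j ∧ l ≠ k ∧ dist (x j) (x l) ≤ 1 ∧ dist (x k) (x l) ≤ 1).card = 5) :
    ∀ l ∈ (Finset.univ.filter fun l : Fin N =>
        l ≠ j ∧ l ≠ k ∧ dist (x j) (x l) ≤ 1 ∧ dist (x k) (x l) ≤ 1),
      ((Finset.univ.filter fun l' : Fin N =>
          l' ≠ j ∧ l' ≠ k ∧ dist (x j) (x l') ≤ 1 ∧ dist (x k) (x l') ≤ 1).filter
        fun l' => l' ≠ l ∧ dist (x l) (x l') ≤ 1).card = 2 :=
  fun l hl => le_antisymm (card_bondedCommon_le_two x j k hjk hdjk hsep l hl)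
    (two_le_card_bondedCommon x j k hjk hdjk hsep hgap h5 l hl)

/-- **Closed ring, in the vocabulary of `stub_fiveFoldSubcubic`.**  Under the extended-gap
hypothesis of the stub (verbatim), for every site `i` whose `2D`-ball is all-Good (`D ≥ 5`),
every site `j` within `D` of `x i` and every five-fold bond `(j,k)` (bonded, exactly five
common neighbours within `1` of both ends), each common neighbour is bonded to exactly two
of the other four: the five tetrahedra on the bond close up into a ring. [folklore] -/
theorem fiveFold_ring_closed_of_deep
    (hGap : ∀ (N : ℕ) (x : Fin N → EuclideanSpace ℝ (Fin 3)) (i j : Fin N),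
      (∀ l : Fin N, dist (x i) (x l) ≤ 4 →
        ((∀ j' : Fin N, dist (x l) (x j') ≤ 11 / 10 → ∀ k : Fin N, k ≠ j' →
            (55 : ℝ) / 57 ≤ dist (x j') (x k)) ∧
          (Finset.univ.filter fun j' : Fin N => j' ≠ l ∧ dist (x l) (x j') ≤ 1).card = 12 ∧
          (Finset.univ.filter fun j' : Fin N => j' ≠ l ∧ dist (x l) (x j') ≤ 11 / 10).card ≤ 12)) →
      1 < dist (x i) (x j) → (131 : ℝ) / 100 ≤ dist (x i) (x j))
    {N : ℕ} (x : Fin N → EuclideanSpace ℝ (Fin 3)) (i : Fin N) (D : ℝ) (hD : 5 ≤ D)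
    (hGood : ∀ j : Fin N, dist (x i) (x j) ≤ 2 * D →
        ((∀ j' : Fin N, dist (x j) (x j') ≤ 11 / 10 → ∀ k : Fin N, k ≠ j' →
            (55 : ℝ) / 57 ≤ dist (x j') (x k)) ∧
          (Finset.univ.filter fun j' : Fin N => j' ≠ j ∧ dist (x j) (x j') ≤ 1).card = 12 ∧
          (Finset.univ.filter fun j' : Fin N => j' ≠ j ∧ dist (x j) (x j') ≤ 11 / 10).card ≤ 12))
    (j k : Fin N) (hij : dist (x i) (x j) ≤ D) (hjk : j ≠ k) (hdjk : dist (x j) (x k) ≤ 1)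
    (h5 : (Finset.univ.filter fun l : Fin N =>
        l ≠ j ∧ l ≠ k ∧ dist (x j) (x l) ≤ 1 ∧ dist (x k) (x l) ≤ 1).card = 5) :
    ∀ l ∈ (Finset.univ.filter fun l : Fin N =>
        l ≠ j ∧ l ≠ k ∧ dist (x j) (x l) ≤ 1 ∧ dist (x k) (x l) ≤ 1),
      ((Finset.univ.filter fun l' : Fin N =>
          l' ≠ j ∧ l' ≠ k ∧ dist (x j) (x l') ≤ 1 ∧ dist (x k) (x l') ≤ 1).filter
        fun l' => l' ≠ l ∧ dist (x l) (x l') ≤ 1).card = 2 := by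
  have hsep := (hGood j (by linarith)).1
  refine fiveFold_ring_closed x j k hjk hdjk hsep ?_ h5
  intro l l' hjl _ hgt
  refine hGap N x l l' (fun l'' h4 => hGood l'' ?_) hgt
  calc dist (x i) (x l'') ≤ dist (x i) (x j) + dist (x j) (x l) + dist (x l) (x l'') :=
        dist_triangle4 _ _ _ _
    _ ≤ 2 * D := by linarith


/-- Registered closed form of `fiveFold_ring_closed_of_deep` (S2α of line `Sketch`): under the
extended gap, in an all-Good `2D`-ball (`D ≥ 5`) the five common neighbours of a five-fold bond
are each bonded to exactly two of the others — the ring is CLOSED. [folklore] -/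
theorem stub_fiveFoldRingClosed :
    (∀ (N : ℕ) (x : Fin N → EuclideanSpace ℝ (Fin 3)) (i j : Fin N),
      (∀ l : Fin N, dist (x i) (x l) ≤ 4 →
        ((∀ j' : Fin N, dist (x l) (x j') ≤ 11 / 10 → ∀ k : Fin N, k ≠ j' →
            (55 : ℝ) / 57 ≤ dist (x j') (x k)) ∧
          (Finset.univ.filter fun j' : Fin N => j' ≠ l ∧ dist (x l) (x j') ≤ 1).card = 12 ∧
          (Finset.univ.filter fun j' : Fin N => j' ≠ l ∧ dist (x l) (x j') ≤ 11 / 10).card ≤ 12)) →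
      1 < dist (x i) (x j) → (131 : ℝ) / 100 ≤ dist (x i) (x j)) →
    ∀ (N : ℕ) (x : Fin N → EuclideanSpace ℝ (Fin 3)) (i : Fin N) (D : ℝ), 5 ≤ D →
    (∀ j : Fin N, dist (x i) (x j) ≤ 2 * D →
        ((∀ j' : Fin N, dist (x j) (x j') ≤ 11 / 10 → ∀ k : Fin N, k ≠ j' →
            (55 : ℝ) / 57 ≤ dist (x j') (x k)) ∧
          (Finset.univ.filter fun j' : Fin N => j' ≠ j ∧ dist (x j) (x j') ≤ 1).card = 12 ∧
          (Finset.univ.filter fun j' : Fin N => j' ≠ j ∧ dist (x j) (x j') ≤ 11 / 10).card ≤ 12)) →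
    ∀ (j k : Fin N), dist (x i) (x j) ≤ D → j ≠ k → dist (x j) (x k) ≤ 1 →
    (Finset.univ.filter fun l : Fin N =>
        l ≠ j ∧ l ≠ k ∧ dist (x j) (x l) ≤ 1 ∧ dist (x k) (x l) ≤ 1).card = 5 →
    ∀ l ∈ (Finset.univ.filter fun l : Fin N =>
        l ≠ j ∧ l ≠ k ∧ dist (x j) (x l) ≤ 1 ∧ dist (x k) (x l) ≤ 1),
      ((Finset.univ.filter fun l : Fin N =>
        l ≠ j ∧ l ≠ k ∧ dist (x j) (x l) ≤ 1 ∧ dist (x k) (x l) ≤ 1).filter fun l' => l' ≠ l ∧ dist (x l) (x l') ≤ 1).card = 2 :=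
  fun hGap _ x i D hD hGood j k hij hjk hdjk h5 =>
    fiveFold_ring_closed_of_deep hGap x i D hD hGood j k hij hjk hdjk h5

end Summit.AtomisticToContinuum.Crystallization.Theorems.SquareWellLayerCakeGapTwelveToBarlow

end
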